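import Literature.AnabelianGeometry.AbsoluteAnabelian.AutHolomorphicSpacesDiscPictureProofs
import Literature.AnabelianGeometry.AbsoluteAnabelian.AutHolomorphicSpacesConjChartProofs
import Literature.AnabelianGeometry.AbsoluteAnabelian.AutHolomorphicSpacesHolTypeProofs
import HarnessLib

/-!
# Disc pictures, anti-holomorphic half (PROOF-ONLY support for [AbsTopIII] Prop. 2.2 (ii))

Continuation of `AutHolomorphicSpacesDiscPictureProofs`: an anti-Möbius disc picture means the
self-homeomorphism is anti-holomorphic at every point, and conversely an everywhere
anti-holomorphic self-homeomorphism has `conj ∘ picture` holomorphic on the ball (conversion between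
the preferred charts and the global disc coordinate).

[cite: MochizukiAbsTopIII2015, Proposition 2.2 (ii) p.52]
-/

noncomputable section

namespace Literature.AnabelianGeometry.AbsoluteAnabelian

universe u

open _root_.TopologicalSpace _root_.Topology _root_.Set _root_.Metric _root_.Function _root_.Filter
open scoped _root_.Manifold _root_.ContDiff ComplexConjugate
open Literature.Analysis.Complex

section PictureRC

variable {Y : Type u} [TopologicalSpace Y] [ChartedSpace ℂ Y] [IsManifold 𝓘(ℂ, ℂ) ω Y]


/-- An anti-Möbius picture means `ψ` is anti-holomorphic at every point.
[cite: MochizukiAbsTopIII2015, Proposition 2.2 (ii) p.52] -/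
theorem isAntiHolAt_of_pic_eqOn_discRot_conj (e : Y ≃ₜ unitDiscOpens)
    (he : MDifferentiable 𝓘(ℂ, ℂ) 𝓘(ℂ, ℂ) e) (hes : MDifferentiable 𝓘(ℂ, ℂ) 𝓘(ℂ, ℂ) e.symm)
    {ψ : Y ≃ₜ Y} {c a : ℂ} (hc : ‖c‖ = 1) (ha : ‖a‖ < 1)
    (h : EqOn (Function.extend Subtype.val (Subtype.val ∘ (e.symm.trans (ψ.trans e))) fun _ => (0 : ℂ))
      (fun z => discRot c a (conj z)) (ball 0 1)) (p : Y) : IsAntiHolAt (⇑ψ) p := by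
  have hRm : MapsTo (discRot c a) (ball 0 1) (ball 0 1) := (isDiscAut_discRot hc ha).mapsTo
  have hloc : ∀ x : Y, ψ x = e.symm ⟨discRot c a (conj (e x : ℂ)), hRm (conj_mem_unitBall (e x).2)⟩ := by
    intro x
    have hx := h (e x).2
    rw [pic_apply, e.symm_apply_apply] at hx
    apply e.injective
    rw [e.apply_symm_apply]
    exact Subtype.ext hx
  exact Filter.Eventually.of_forall fun y =>
    ⟨ψ.continuous.continuousAt, differentiableAt_conj_writtenInExtChartAt_of_eventually (⇑ψ) y e (he y)
      e.symm hes (isDiscAut_discRot hc ha).differentiableOn hRm (Filter.Eventually.of_forall hloc)⟩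

/-- **Everywhere anti-holomorphic self-homeomorphisms have anti-holomorphic pictures**: if `ψ` is
anti-holomorphic at every point, then `conj ∘ pic ψ` is holomorphic on the ball (conversion from
the preferred charts to the global disc coordinate). [cite: MochizukiAbsTopIII2015, Proposition 2.2 (ii) p.52] -/
theorem differentiableOn_conj_pic (e : Y ≃ₜ unitDiscOpens)
    (he : MDifferentiable 𝓘(ℂ, ℂ) 𝓘(ℂ, ℂ) e) (hes : MDifferentiable 𝓘(ℂ, ℂ) 𝓘(ℂ, ℂ) e.symm)
    {ψ : Y ≃ₜ Y} (h : ∀ p : Y, IsAntiHolAt (⇑ψ) p) :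
    DifferentiableOn ℂ (conj ∘ Function.extend Subtype.val (Subtype.val ∘ (e.symm.trans (ψ.trans e)))
      fun _ => (0 : ℂ)) (ball 0 1) := by
  intro z hz
  set P := Function.extend Subtype.val (Subtype.val ∘ (e.symm.trans (ψ.trans e))) (fun _ => (0 : ℂ))
    with hP
  set p : Y := e.symm ⟨z, hz⟩ with hp
  set cX := chartAt ℂ p with hcX
  set cY := chartAt ℂ (ψ p) with hcY
  set W := writtenInExtChartAt 𝓘(ℂ, ℂ) 𝓘(ℂ, ℂ) p (⇑ψ) with hWdef
  -- data from `IsAntiHolAt ψ p` at the point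
  have hW : DifferentiableAt ℂ (conj ∘ W) (cX p) := by
    have h1 := (h p).self_of_nhds.2
    have hpt : extChartAt 𝓘(ℂ, ℂ) p p = cX p := by simp [hcX]
    rw [hpt] at h1
    exact h1
  have hWapp : ∀ v, W v = cY (ψ (cX.symm v)) := fun v => by
    simp [hWdef, writtenInExtChartAt, hcX, hcY]
  -- `A := val ∘ e ∘ cY⁻¹` (total) and `B := cX ∘ e⁻¹` (extended off the disc)
  set A : ℂ → ℂ := Subtype.val ∘ ⇑e ∘ cY.symm with hA
  set B : ℂ → ℂ := Function.extend Subtype.val (cX ∘ ⇑e.symm) fun _ => (0 : ℂ) with hB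
  have hAd : DifferentiableAt ℂ A (cY (ψ p)) := by
    have h1 : MDifferentiableAt 𝓘(ℂ, ℂ) 𝓘(ℂ, ℂ) (⇑e ∘ cY.symm) (cY (ψ p)) := by
      refine (he _).comp _ ?_
      exact mdifferentiableAt_atlas_symm (chart_mem_atlas ℂ (ψ p)) (mem_chart_target ℂ (ψ p))
    exact differentiableAt_val_comp_of_mdifferentiableAt h1
  have hBd : DifferentiableAt ℂ B z := by
    have h1 : MDifferentiableAt 𝓘(ℂ, ℂ) 𝓘(ℂ, ℂ) (cX ∘ ⇑e.symm) ⟨z, hz⟩ := by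
      refine MDifferentiableAt.comp _ ?_ (hes _)
      exact mdifferentiableAt_atlas (chart_mem_atlas ℂ p) (mem_chart_source ℂ p)
    exact differentiableAt_extend_of_mdifferentiableAt (x := ⟨z, hz⟩) h1
  have hBapp : ∀ {w : ℂ} (hw : w ∈ ball (0 : ℂ) 1), B w = cX (e.symm ⟨w, hw⟩) := fun hw => by
    rw [hB, extend_apply_of_mem _ _ hw]; rfl
  have hBz : B z = cX p := hBapp hz
  -- the point map `ι := e⁻¹` extended off the disc, continuous at `z`
  set ι : ℂ → Y := Function.extend Subtype.val (⇑e.symm) fun _ => p with hι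
  have hιapp : ∀ {w : ℂ} (hw : w ∈ ball (0 : ℂ) 1), ι w = e.symm ⟨w, hw⟩ := fun hw =>
    extend_apply_of_mem _ _ hw
  have hιc : ContinuousAt ι z := by
    have hf : ι ∘ Subtype.val = ⇑e.symm := funext fun x => by
      simp only [comp_apply, hι]; exact Subtype.val_injective.extend_apply _ _ x
    have : ContinuousAt (ι ∘ (Subtype.val : unitDiscOpens → ℂ)) ⟨z, hz⟩ := by
      rw [hf]; exact e.symm.continuous.continuousAt
    exact (unitDiscOpens.isOpenEmbedding'.continuousAt_iff (f := Subtype.val)).1 this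
  have hιz : ι z = p := hιapp hz
  -- `conj ∘ P = (conj ∘ A ∘ conj) ∘ (conj ∘ W) ∘ B` near `z`
  have hnear : ∀ᶠ w in 𝓝 z, (conj ∘ P) w = ((conj ∘ A ∘ conj) ∘ (conj ∘ W) ∘ B) w := by
    have c0 : ∀ᶠ w in 𝓝 z, w ∈ ball (0 : ℂ) 1 := isOpen_ball.mem_nhds hz
    have c1 : ∀ᶠ w in 𝓝 z, ι w ∈ cX.source := by
      apply hιc.preimage_mem_nhds
      rw [hιz]; exact cX.open_source.mem_nhds (mem_chart_source ℂ p)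
    have c2 : ∀ᶠ w in 𝓝 z, ψ (ι w) ∈ cY.source := by
      apply (ψ.continuous.continuousAt.comp hιc).preimage_mem_nhds
      rw [comp_apply, hιz]; exact cY.open_source.mem_nhds (mem_chart_source ℂ (ψ p))
    filter_upwards [c0, c1, c2] with w hw0 hw1 hw2
    rw [hιapp hw0] at hw1 hw2
    simp only [comp_apply, Complex.conj_conj, hP, pic_apply_of_mem e ψ hw0, hBapp hw0, hWapp, hA,
      cX.left_inv hw1, cY.left_inv hw2]
  refine DifferentiableAt.differentiableWithinAt ((Filter.EventuallyEq.differentiableAt_iff hnear).2 ?_)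
  have hWB : DifferentiableAt ℂ ((conj ∘ W) ∘ B) z := by
    refine DifferentiableAt.comp _ ?_ hBd
    rw [hBz]; exact hW
  refine DifferentiableAt.comp _ ?_ hWB
  have hpt : ((conj ∘ W) ∘ B) z = conj (cY (ψ p)) := by
    simp only [comp_apply, hBz, hWapp, cX.left_inv (mem_chart_source ℂ p)]
  rw [hpt, differentiableAt_conj_conj_iff, Complex.conj_conj]
  exact hAd

end PictureRC

end Literature.AnabelianGeometry.AbsoluteAnabelian
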